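import Literature.NumberTheory.Weil1964.ArchDualPairThetaMajorants
import Literature.NumberTheory.Automorphic.UnitaryGroupArchimedeanPlaces
import Literature.RepresentationTheory.KonnoKonno2007.RealDualPairNoPositiveCharacter
import HarnessLib

/-!
# The archimedean unitary group `U(J)(E ⊗ ℝ) = Π_w U(σ_w J)(ℂ)` of a hermitian form of place-wise real rank `≤ 1` carries no non-trivial continuous positive character

Topic `NumberTheory/Weil1964`; namespace `Literature.NumberTheory.Weil1964`.  KERNEL MATHEMATICS ONLY: proved theorems;
no definition, no `def … : Prop` record, no axiom, no proof hole.

The unitary-lift clause (w2′) of the archimedean Weil datum read off the pinned adelic splitting of a hermitian dual pair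
(`ArchWeilDatumOfCoefficients.isArchWeilDatum_of_coeff`) needs, on the archimedean pair group
`G_∞ = U(J_V)(E ⊗ ℝ) × U(J_W)(E ⊗ ℝ)` (`UnitaryGroup.arch`), the input «every continuous positive multiplicative function
is `1`».  `KonnoKonno2007/RealDualPairNoPositiveCharacter` proves it for the standard real groups `UForm P Q = U(|P|,|Q|)`
of real rank `≤ 1`; this file transports it to `U(J)(E ⊗ ℝ)`:

* §1 `mulPos_eq_one_of_continuousMulEquiv`, `continuous_subgroupCongr` — transport tools;
* §2 `mulPos_eq_one_unitaryGroupOfForm_of_sylvester` — along the Sylvester datum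
  `diag(D)ᴴ · (c′ • diag(1_P, −1_Q))^ε · diag(D) = H` of `ArchFollandDualPair` §4 (`toUForm` = conjugation · reindexing ·
  `U(c′ H₀) = U(H₀)`, all topological isomorphisms: `unitaryGroupOfFormCongrOfEq`, `unitaryGroupOfFormReindex`,
  `MulEquiv.subgroupCongr`), `U(H)(ℂ) = unitaryGroupOfForm conj H` inherits the property from `UForm P Q`;
* §3 `UnitaryGroup.mulPos_eq_one_arch` — along the place decomposition
  `UnitaryGroup.archPiEquiv : U(J)(E ⊗ ℝ) ≃ₜ* Π_w U(σ_w J)(ℂ)` (`UnitaryGroupArchimedeanPlaces`, `c ≠ 1` fixing every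
  infinite place), the property of every local factor `archLocal E N J w` gives it for `U(J)(E ⊗ ℝ)`
  (`mulPos_pi_eq_one`); `mulPos_eq_one_archLocal_of_sylvester` is the per-place form of §2, and
  `UnitaryGroup.mulPos_eq_one_archPair` the pair `U(J_V)(E ⊗ ℝ) × U(J_W)(E ⊗ ℝ)` (`mulPos_prod_eq_one`);
* §4 `mulPos_eq_one_unitaryGroupOfForm_realDiagonal` — a REAL DIAGONAL form in its canonical sign frame (`signSplit`,
  `sqrtAbs` of `ArchDualPairThetaMajorants` §0) with at most one negative entry, or negative definite;
  `UnitaryGroup.mulPos_eq_one_archLocal_diagonal` / `UnitaryGroup.mulPos_eq_one_arch_diagonal` — the diagonal forms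
  `J = diag(t₀) ⊗ 1` of the theta correspondence, from SIGN FACTS `σ_v(t₀)` place by place (`archLocalForm_eq_map`,
  `realPlaceMap`): the form in which the archimedean pair group of [GelbartRogawski1991, §3.1] is fed in.

The Sylvester data per complex place (sign frame `ε_w`, adapted scaling `D_w`, scalar `c′_w`) are the consumer's, exactly as
in `ArchFollandDualPair.archUForm` / `ArchDualPairThetaMajorants` (`signSplit`, `sqrtAbs`, `placeSignVec`,
`archLocalForm_diagonal`).  Everything is PROVED; no cited statement is a hypothesis.

## References

* [PlatonovRapinchuk1994] V. Platonov, A. Rapinchuk, *Algebraic Groups and Number Theory*, Academic Press (1994), §2.3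
  (hermitian forms over `ℂ/ℝ`, Sylvester), §7.1 (archimedean factors).
* [Knapp2002] A. W. Knapp, *Lie Groups Beyond an Introduction*, 2nd ed., Birkhäuser (2002), Thm 7.39 (`G = K A K`).
* [Folland1989] G. B. Folland, *Harmonic Analysis in Phase Space*, Princeton UP (1989), §4.2, the Schur remark p. 156
  (where the input is consumed).

## Provenance

LEAN-IN-TREE rule (2026-08-18), pub-hodgecm model-construction sub-cell, discharge seat mc-discharge-3 (ticket D-3, (J-arch)
(w2′) = BINDER-OWNERS §1a rows 10/16/17 sub-item (c4), at the census site of record `arch J_V × arch J_W`).  Nothing here is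
a claim of the manuscripts adjudicated by that cell.
-/

noncomputable section

open scoped Matrix ComplexConjugate
open Complex NumberField NumberField.InfinitePlace NumberField.mixedEmbedding
open Literature.NumberTheory.Automorphic Literature.NumberTheory.Automorphic.UnitaryGroup
open Literature.RepresentationTheory.KonnoKonno2007 Literature.RepresentationTheory.KonnoKonno2007.RealDualPair

namespace Literature.NumberTheory.Weil1964

/-! ## §1 Transport tools -/

section Transport

/-- Transport along a topological group isomorphism `e : H ≃ₜ* G`. [folklore] -/
theorem mulPos_eq_one_of_continuousMulEquiv {H G : Type*} [Group H] [Group G] [TopologicalSpace H]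
    [TopologicalSpace G] (e : H ≃ₜ* G)
    (hH : ∀ n : H → ℝ, (∀ g h, n (g * h) = n g * n h) → (∀ g, 0 < n g) → Continuous n → ∀ g, n g = 1)
    (n : G → ℝ) (hn : ∀ g h, n (g * h) = n g * n h) (hpos : ∀ g, 0 < n g) (hcont : Continuous n) (g : G) :
    n g = 1 :=
  mulPos_eq_one_of_surjective e.toMulEquiv.toMonoidHom e.continuous e.surjective hH n hn hpos hcont g

/-- `MulEquiv.subgroupCongr` (equal subgroups) is continuous. [folklore] -/
theorem continuous_subgroupCongr {G : Type*} [Group G] [TopologicalSpace G] {H K : Subgroup G} (h : H = K) :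
    Continuous (MulEquiv.subgroupCongr h) := by
  subst h
  exact continuous_id

end Transport

/-! ## §2 Along a Sylvester datum: `U(H)(ℂ)` for `H ≅ c′ • diag(1_P, −1_Q)` -/

section Sylvester

variable {n : Type*} [Fintype n] [DecidableEq n] {P Q : Type*} [Fintype P] [DecidableEq P] [Fintype Q]
  [DecidableEq Q]

/-- **`U(⋆, H)` inherits the property from `U(P,Q)` along a Sylvester datum** `diag(D)ᴴ (c′ • diag(1,−1))^ε diag(D) = H`:
the three maps of `toUForm` are topological group isomorphisms, so their inverses give a continuous surjective
homomorphism `U(P,Q) → U(⋆, H)`. [cite: PlatonovRapinchuk1994, §2.3] -/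
theorem mulPos_eq_one_unitaryGroupOfForm_of_sylvester (ε : n ≃ P ⊕ Q) {D : n → ℝ} (hD0 : ∀ j, D j ≠ 0) {c' : ℝ}
    (hc' : c' ≠ 0) {H : Matrix n n ℂ}
    (hH : formCongr (starRingEnd ℂ) (scaleGL D hD0) (((c' : ℂ) • signForm P Q).submatrix ε ε) = H)
    (hPQ : ∀ m : UForm P Q → ℝ, (∀ g h, m (g * h) = m g * m h) → (∀ g, 0 < m g) → Continuous m → ∀ g, m g = 1)
    (m : unitaryGroupOfForm (starRingEnd ℂ) H → ℝ) (hm : ∀ g h, m (g * h) = m g * m h) (hpos : ∀ g, 0 < m g)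
    (hcont : Continuous m) (g : unitaryGroupOfForm (starRingEnd ℂ) H) : m g = 1 := by
  -- `U(sF) → U(c′ • sF)` (equal subgroups)
  have h1 := mulPos_eq_one_of_surjective
    (MulEquiv.subgroupCongr (unitaryGroupOfForm_smul_eq (signForm P Q) hc')).symm.toMonoidHom
    (continuous_subgroupCongr (unitaryGroupOfForm_smul_eq (signForm P Q) hc').symm)
    (MulEquiv.subgroupCongr (unitaryGroupOfForm_smul_eq (signForm P Q) hc')).symm.surjective hPQ
  -- `U(c′ • sF) → U((c′ • sF)^ε)` (reindexing)
  have h2 := mulPos_eq_one_of_continuousMulEquiv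
    (unitaryGroupOfFormReindex (starRingEnd ℂ) ε ((c' : ℂ) • signForm P Q)).symm h1
  -- `U((c′ • sF)^ε) → U(H)` (conjugation by the Sylvester datum)
  exact mulPos_eq_one_of_continuousMulEquiv
    (unitaryGroupOfFormCongrOfEq (starRingEnd ℂ) (scaleGL D hD0) (((c' : ℂ) • signForm P Q).submatrix ε ε) H hH).symm
    h2 m hm hpos hcont g

end Sylvester

/-! ## §3 Along the place decomposition `U(J)(E ⊗ ℝ) ≃ₜ* Π_w U(σ_w J)(ℂ)` -/

section Places

variable (F E : Type) [Field F] [NumberField F] [Field E] [NumberField E] [Algebra F E]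
  (c : E ≃ₐ[F] E) (N : ℕ) (J : Matrix (Fin N) (Fin N) E)

omit [NumberField E] in
/-- **Per place**: `U(σ_w J)(ℂ) = archLocal E N J w` inherits the property from `U(P,Q)` along a Sylvester datum of
`σ_w J`. [cite: PlatonovRapinchuk1994, §2.3] -/
theorem mulPos_eq_one_archLocal_of_sylvester (w : {w : InfinitePlace E // IsComplex w}) {P Q : Type*} [Fintype P]
    [DecidableEq P] [Fintype Q] [DecidableEq Q] (ε : Fin N ≃ P ⊕ Q) {D : Fin N → ℝ} (hD0 : ∀ j, D j ≠ 0) {c' : ℝ}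
    (hc' : c' ≠ 0)
    (hH : formCongr (starRingEnd ℂ) (scaleGL D hD0) (((c' : ℂ) • signForm P Q).submatrix ε ε) = J.map w.1.embedding)
    (hPQ : ∀ m : UForm P Q → ℝ, (∀ g h, m (g * h) = m g * m h) → (∀ g, 0 < m g) → Continuous m → ∀ g, m g = 1)
    (m : archLocal E N J w → ℝ) (hm : ∀ g h, m (g * h) = m g * m h) (hpos : ∀ g, 0 < m g) (hcont : Continuous m)
    (g : archLocal E N J w) : m g = 1 :=
  mulPos_eq_one_unitaryGroupOfForm_of_sylvester ε hD0 hc' hH hPQ m hm hpos hcont g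

omit [NumberField F] in
/-- **`U(J)(E ⊗ ℝ)` carries no non-trivial continuous positive multiplicative function** as soon as every local factor
`U(σ_w J)(ℂ)` (`w` complex) has that property — transport along `UnitaryGroup.archPiEquiv` (`c ≠ 1` fixing every
infinite place of `E`, e.g. complex conjugation of a CM field). [cite: BorelJacquet1979, §4.1] -/
theorem UnitaryGroup.mulPos_eq_one_arch (hc : c ≠ 1) (hfix : ∀ w : InfinitePlace E, c • w = w)
    (h : ∀ (w : {w : InfinitePlace E // IsComplex w}) (m : archLocal E N J w → ℝ),
      (∀ g g', m (g * g') = m g * m g') → (∀ g, 0 < m g) → Continuous m → ∀ g, m g = 1)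
    (m : arch F E c N J → ℝ) (hm : ∀ g h, m (g * h) = m g * m h) (hpos : ∀ g, 0 < m g) (hcont : Continuous m)
    (g : arch F E c N J) : m g = 1 := by
  classical
  exact mulPos_eq_one_of_continuousMulEquiv (archPiEquiv F E c N J hc hfix).symm
    (mulPos_pi_eq_one (H := fun w : {w : InfinitePlace E // IsComplex w} => archLocal E N J w) h) m hm hpos hcont g

omit [NumberField F] [NumberField E] in
/-- **The archimedean pair group `U(J_V)(E ⊗ ℝ) × U(J_W)(E ⊗ ℝ)`** from the two factors. [folklore] -/
theorem UnitaryGroup.mulPos_eq_one_archPair {M : ℕ} (JW : Matrix (Fin M) (Fin M) E)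
    (hV : ∀ m : arch F E c N J → ℝ, (∀ g h, m (g * h) = m g * m h) → (∀ g, 0 < m g) → Continuous m → ∀ g, m g = 1)
    (hW : ∀ m : arch F E c M JW → ℝ, (∀ g h, m (g * h) = m g * m h) → (∀ g, 0 < m g) → Continuous m → ∀ g, m g = 1)
    (m : arch F E c N J × arch F E c M JW → ℝ) (hm : ∀ g h, m (g * h) = m g * m h) (hpos : ∀ g, 0 < m g)
    (hcont : Continuous m) (g : arch F E c N J × arch F E c M JW) : m g = 1 :=
  mulPos_prod_eq_one hV hW m hm hpos hcont g

end Places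

/-! ## §4 Real diagonal forms in their canonical sign frames; diagonal `J = diag(t₀) ⊗ 1` place by place -/

section Diagonal

/-- **A real diagonal form `diag(x)` with at most one negative entry, or negative definite**: `U(diag x)(ℂ)` carries
no non-trivial continuous positive multiplicative function — canonical sign frame `signSplit x`, adapted scaling
`sqrtAbs x` (`ArchDualPairThetaMajorants` §0), and the rank profiles of `RealDualPairNoPositiveCharacter`.
[cite: PlatonovRapinchuk1994, §2.3] -/
theorem mulPos_eq_one_unitaryGroupOfForm_realDiagonal {N : ℕ} (x : Fin N → ℝ) (hx : ∀ i, x i ≠ 0)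
    (hprof : (∃ i₀, ∀ i, i ≠ i₀ → 0 < x i) ∨ ∀ i, x i < 0)
    (m : unitaryGroupOfForm (starRingEnd ℂ) ((Matrix.diagonal x).map Complex.ofRealHom) → ℝ)
    (hm : ∀ g h, m (g * h) = m g * m h) (hpos : ∀ g, 0 < m g) (hcont : Continuous m)
    (g : unitaryGroupOfForm (starRingEnd ℂ) ((Matrix.diagonal x).map Complex.ofRealHom)) : m g = 1 := by
  have ht : ∀ j, x j = 1 * signOf (signSplit x j) * sqrtAbs x j ^ 2 := fun j => by
    rw [one_mul, sqrtAbs_sq, signOf_signSplit_mul_abs x j (hx j)]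
  have hH := formCongr_scaleGL_smul_signForm (signSplit x) (fun j => sqrtAbs_ne_zero (hx j)) 1 ht
  refine mulPos_eq_one_unitaryGroupOfForm_of_sylvester (signSplit x) (fun j => sqrtAbs_ne_zero (hx j)) one_ne_zero hH
    ?_ m hm hpos hcont g
  rcases hprof with ⟨i₀, hi₀⟩ | hneg
  · haveI : Subsingleton (NegIdx x) := Fintype.card_le_one_iff_subsingleton.mp (card_negIdx_le_one i₀ hi₀)
    by_cases hQ : IsEmpty (NegIdx x)
    · exact UForm.mulPos_eq_one_of_isEmpty_right
    · by_cases hP : IsEmpty (PosIdx x)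
      · exact UForm.mulPos_eq_one_of_isEmpty_left
      · obtain ⟨q₀⟩ := not_isEmpty_iff.mp hQ
        obtain ⟨p₀⟩ := not_isEmpty_iff.mp hP
        exact UForm.mulPos_eq_one_of_rankOne p₀ q₀
  · haveI := isEmpty_posIdx hneg
    exact UForm.mulPos_eq_one_of_isEmpty_left

variable (F E : Type) [Field F] [NumberField F] [Field E] [NumberField E] [Algebra F E]
  (c : E ≃ₐ[F] E) (N : ℕ) (J : Matrix (Fin N) (Fin N) E)

/-- **Per place, diagonal form `J = diag(t₀) ⊗ 1`**: at a complex place `w` fixed by `c ≠ 1`, `σ_w J = diag(σ_v t₀)`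
(`archLocalForm_eq_map`, `realPlaceMap`); if `σ_v t₀` has at most one negative entry or is negative everywhere then
`U(σ_w J)(ℂ)` carries no non-trivial continuous positive multiplicative function. [cite: PlatonovRapinchuk1994, §2.3] -/
theorem UnitaryGroup.mulPos_eq_one_archLocal_diagonal (w : {w : InfinitePlace E // IsComplex w}) (hw : c • w.1 = w.1)
    (hc : c ≠ 1) (t₀ : Fin N → F) (hJ : J = (Matrix.diagonal t₀).map (algebraMap F E)) (ht₀ : ∀ i, t₀ i ≠ 0)
    (hprof : (∃ i₀, ∀ i, i ≠ i₀ → 0 < UnitaryGroup.realPlaceMap F E c w hw hc (t₀ i)) ∨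
      ∀ i, UnitaryGroup.realPlaceMap F E c w hw hc (t₀ i) < 0)
    (m : archLocal E N J w → ℝ) (hm : ∀ g h, m (g * h) = m g * m h) (hpos : ∀ g, 0 < m g) (hcont : Continuous m)
    (g : archLocal E N J w) : m g = 1 := by
  have hJw : J.map w.1.embedding =
      (Matrix.diagonal fun i => UnitaryGroup.realPlaceMap F E c w hw hc (t₀ i)).map Complex.ofRealHom := by
    rw [UnitaryGroup.archLocalForm_eq_map F E c N w hw hc (Matrix.diagonal t₀) hJ, Matrix.diagonal_map (map_zero _)]
  have heq : unitaryGroupOfForm (starRingEnd ℂ)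
      ((Matrix.diagonal fun i => UnitaryGroup.realPlaceMap F E c w hw hc (t₀ i)).map Complex.ofRealHom) =
        archLocal E N J w := by
    rw [← hJw]; rfl
  exact mulPos_eq_one_of_surjective (MulEquiv.subgroupCongr heq).toMonoidHom (continuous_subgroupCongr heq)
    (MulEquiv.subgroupCongr heq).surjective
    (mulPos_eq_one_unitaryGroupOfForm_realDiagonal _ (fun i => (map_ne_zero _).2 (ht₀ i)) hprof) m hm hpos hcont g

/-- **`U(diag(t₀) ⊗ 1)(E ⊗ ℝ)` of place-wise real rank `≤ 1`** (at every complex place `w`, `σ_v t₀` has at most one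
negative entry or is negative everywhere; `c ≠ 1` fixes every infinite place): no non-trivial continuous positive
multiplicative function. [cite: PlatonovRapinchuk1994, §2.3; Knapp2002, Thm 7.39] -/
theorem UnitaryGroup.mulPos_eq_one_arch_diagonal (hc : c ≠ 1) (hfix : ∀ w : InfinitePlace E, c • w = w)
    (t₀ : Fin N → F) (hJ : J = (Matrix.diagonal t₀).map (algebraMap F E)) (ht₀ : ∀ i, t₀ i ≠ 0)
    (hprof : ∀ w : {w : InfinitePlace E // IsComplex w},
      (∃ i₀, ∀ i, i ≠ i₀ → 0 < UnitaryGroup.realPlaceMap F E c w (hfix w.1) hc (t₀ i)) ∨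
        ∀ i, UnitaryGroup.realPlaceMap F E c w (hfix w.1) hc (t₀ i) < 0)
    (m : arch F E c N J → ℝ) (hm : ∀ g h, m (g * h) = m g * m h) (hpos : ∀ g, 0 < m g) (hcont : Continuous m)
    (g : arch F E c N J) : m g = 1 :=
  UnitaryGroup.mulPos_eq_one_arch F E c N J hc hfix
    (fun w => UnitaryGroup.mulPos_eq_one_archLocal_diagonal F E c N J w (hfix w.1) hc t₀ hJ ht₀ (hprof w)) m hm hpos
    hcont g

end Diagonal

end Literature.NumberTheory.Weil1964
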